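import Mathlib
import HarnessLib
import Summits.SmoothPoincare4.Statement
import Summits.SmoothPoincare4.SmoothPoincare4.Theses.ConvexBisection
import Literature.Geometry.Symplectic.SteinDomain
import Literature.Geometry.Symplectic.SteinBoundaryContact
import Literature.Geometry.Symplectic.PlanarContactBoundary
import Literature.Topology.FourManifolds.ClosedBall
import Literature.Topology.FourManifolds.Gluing
import Literature.Topology.FourManifolds.ConnectedSum
import Literature.Topology.FourManifolds.ComplexProjectiveSpace
import Literature.Topology.FourManifolds.BalancedPresentation

/-!
# Sketch — first lemmas of three crux ideas for `ConvexBisection.PlanarBisectionRigidity`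
(crux-ideate round 1, ideator 3).  Statements only (Props over existing declarations); nothing
is proved here.  Namespace is a scratch namespace; these are NOT route items.
-/

noncomputable section

open scoped Manifold ContDiff Topology ContinuousMap
open Set Function

namespace Summit.SmoothPoincare4.SmoothPoincare4.Cruxes.PlanarBisectionRigidity.Sketch

local notation "𝔼 " n:arg => EuclideanSpace ℝ (Fin n)
local notation "𝕊 " n:arg => (Metric.sphere (0 : EuclideanSpace ℝ (Fin (n + 1))) 1)
local notation "𝔻 " n:arg => (Metric.closedBall (0 : EuclideanSpace ℝ (Fin n)) 1)

open Literature.Geometry.Symplectic Literature.Topology.FourManifolds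

/-! ## Card A (seam-walking to a ball) — the absorbing target.

ONE-SIDED BALL LEMMA: a closed 4-manifold with a common-contact Stein bisection ONE of whose
halves is diffeomorphic to the closed 4-ball is diffeomorphic to `S⁴` (no homotopy-sphere or
planarity hypothesis: the other half is a Stein filling of the tight `S³`, hence a ball by
Eliashberg, and `Γ₄ = 0`).  This is the statement the seam-walk terminates in: the walk produces
a NEW bisection of the same `Σ` whose positive block is recognised as `𝔻⁴` by handle
cancellation, while the negative block is arbitrary. -/
def OneSidedBallSeam : Prop :=
  ∀ (X : Type) [TopologicalSpace X] [T2Space X] [SecondCountableTopology X] [CompactSpace X]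
    [ChartedSpace (𝔼 4) X] [IsManifold (𝓡 4) ∞ X]
    (W₁ : Type) [TopologicalSpace W₁] [ChartedSpace (EuclideanHalfSpace 4) W₁]
    [IsManifold (𝓡∂ 4) ∞ W₁] [CompactSpace W₁]
    (W₂ : Type) [TopologicalSpace W₂] [ChartedSpace (EuclideanHalfSpace 4) W₂]
    [IsManifold (𝓡∂ 4) ∞ W₂] [CompactSpace W₂]
    (J₁ : SteinStructure W₁) (J₂ : SteinStructure W₂) (e₁ : W₁ → X) (e₂ : W₂ → X),
    Manifold.IsSmoothEmbedding (𝓡∂ 4) (𝓡 4) ∞ e₁ → Manifold.IsSmoothEmbedding (𝓡∂ 4) (𝓡 4) ∞ e₂ →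
    Set.range e₁ ∪ Set.range e₂ = Set.univ →
    Set.range e₁ ∩ Set.range e₂ = e₁ '' (𝓡∂ 4).boundary W₁ →
    Set.range e₁ ∩ Set.range e₂ = e₂ '' (𝓡∂ 4).boundary W₂ →
    (∀ w₁ w₂, e₁ w₁ = e₂ w₂ →
      Submodule.map (mfderiv (𝓡∂ 4) (𝓡 4) e₁ w₁).toLinearMap (contactPlane J₁.J w₁) =
        Submodule.map (mfderiv (𝓡∂ 4) (𝓡 4) e₂ w₂).toLinearMap (contactPlane J₂.J w₂)) →
    Nonempty (W₁ ≃ₘ⟮𝓡∂ 4, 𝓡∂ 4⟯ (𝔻 4)) →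
    Nonempty (X ≃ₘ⟮𝓡 4, 𝓡 4⟯ (𝕊 4))

/-! ## Card B (one cap for two fillings) — the free stabilised corollary, typed.

`IsProjectiveStabilization m M P`: `P` is an `m`-fold connected sum of `M` with copies of `ℂℙ²`
taken WITHOUT orientation control (the tree's `IsConnectedSum` is orientation-free, so each
summand is `ℂℙ²` or `ℂℙ²bar`).  Pattern of `Literature.Topology.FourManifolds.IsStabilization`. -/
def IsProjectiveStabilization : ℕ → ∀ (M : Type) [TopologicalSpace M] [ChartedSpace (𝔼 4) M]
    (P : Type) [TopologicalSpace P] [ChartedSpace (𝔼 4) P], Prop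
  | 0, M, _, _, P, _, _ => Nonempty (M ≃ₘ⟮𝓡 4, 𝓡 4⟯ P)
  | m + 1, M, _, _, P, _, _ =>
    ∃ (M' : Type) (_ : TopologicalSpace M') (_ : T2Space M') (_ : ChartedSpace (𝔼 4) M')
      (_ : IsManifold (𝓡 4) ∞ M'),
      IsProjectiveStabilization m M M' ∧
        IsConnectedSum (𝓡 4) (𝓡 4) (𝓡 4) M' ComplexProjectivePlane P

/-- BINDING-NUMBER DISSOLUTION: if a homotopy 4-sphere `M` has a common-contact Stein bisection
whose seam contact structure is supported by a planar open book with `k` binding components, then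
`M` and `S⁴` have a common `(2k+1)`-fold `±ℂℙ²`-stabilisation (informally
`M # (k+1)ℂℙ² # kℂℙ²bar ≅ (k+1)ℂℙ² # kℂℙ²bar`): surgery on the `k` binding circles turns `M`
into the total space of an achiral genus-0 Lefschetz fibration over `S²`, which is standard.  The
hypothesis is `PlanarBisectionRigidity`'s with the open book made explicit so that `k = ob.k` is
visible. -/
def BindingNumberDissolution : Prop :=
  ∀ (M : Type) [TopologicalSpace M] [T2Space M] [SecondCountableTopology M]
    [ChartedSpace (𝔼 4) M] [IsManifold (𝓡 4) ∞ M], M ≃ₕ (𝕊 4) →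
    ∀ (W₁ : Type) [TopologicalSpace W₁] [ChartedSpace (EuclideanHalfSpace 4) W₁]
    [IsManifold (𝓡∂ 4) ∞ W₁] [CompactSpace W₁]
    (W₂ : Type) [TopologicalSpace W₂] [ChartedSpace (EuclideanHalfSpace 4) W₂]
    [IsManifold (𝓡∂ 4) ∞ W₂] [CompactSpace W₂]
    (J₁ : SteinStructure W₁) (J₂ : SteinStructure W₂) (e₁ : W₁ → M) (e₂ : W₂ → M)
    (b : BoundaryData (𝓡∂ 4) W₁ (𝓡 3)) (ob : OpenBook b.carrier),
    Manifold.IsSmoothEmbedding (𝓡∂ 4) (𝓡 4) ∞ e₁ → Manifold.IsSmoothEmbedding (𝓡∂ 4) (𝓡 4) ∞ e₂ →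
    Set.range e₁ ∪ Set.range e₂ = Set.univ →
    Set.range e₁ ∩ Set.range e₂ = e₁ '' (𝓡∂ 4).boundary W₁ →
    Set.range e₁ ∩ Set.range e₂ = e₂ '' (𝓡∂ 4).boundary W₂ →
    (∀ w₁ w₂, e₁ w₁ = e₂ w₂ →
      Submodule.map (mfderiv (𝓡∂ 4) (𝓡 4) e₁ w₁).toLinearMap (contactPlane J₁.J w₁) =
        Submodule.map (mfderiv (𝓡∂ 4) (𝓡 4) e₂ w₂).toLinearMap (contactPlane J₂.J w₂)) →
    ob.IsPlanar → ob.Supports (boundaryPlaneField J₁.J b) →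
    ∃ (P : Type) (_ : TopologicalSpace P) (_ : T2Space P) (_ : ChartedSpace (𝔼 4) P)
      (_ : IsManifold (𝓡 4) ∞ P),
      IsProjectiveStabilization (2 * ob.k + 1) M P ∧
        IsProjectiveStabilization (2 * ob.k + 1) (𝕊 4) P

/-- Card B, residual statement after configuration uniqueness (U): CONTACT-TWISTED PLANAR
DOUBLES.  A closed 4-manifold obtained by gluing a compact contractible Stein domain `W` with
planar contact boundary to itself along a self-diffeomorphism `χ` of `∂W` preserving the induced
plane field (a contactomorphism up to co-orientation) is diffeomorphic to `S⁴`.  (Planar slice of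
crux `ContractibleTwistedDoubleStandard` with `W₁ = W₂`; `χ = id` is `PlanarSteinDoubleStandard`.) -/
def ContactTwistedPlanarDouble : Prop :=
  ∀ (W : Type) [TopologicalSpace W] [T2Space W] [SecondCountableTopology W]
    [ChartedSpace (EuclideanHalfSpace 4) W] [IsManifold (𝓡∂ 4) ∞ W] [CompactSpace W]
    [ContractibleSpace W] (J : SteinStructure W) (b : BoundaryData (𝓡∂ 4) W (𝓡 3))
    (χ : b.carrier ≃ₘ⟮𝓡 3, 𝓡 3⟯ b.carrier),
    PlanarContactBoundary J →
    (∀ y : b.carrier, Submodule.map (mfderiv (𝓡 3) (𝓡 3) χ y).toLinearMap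
        (boundaryPlaneField J.J b y) = boundaryPlaneField J.J b (χ y)) →
    ∀ (X : Type) [TopologicalSpace X] [T2Space X] [SecondCountableTopology X]
      [ChartedSpace (𝔼 4) X] [IsManifold (𝓡 4) ∞ X],
      IsBoundaryGluing b b χ (𝓡 4) X → Nonempty (X ≃ₘ⟮𝓡 4, 𝓡 4⟯ (𝕊 4))

/-! ## Card C (coloured string links / square-free Andrews–Curtis) -/

/-- PLANAR STEIN DOUBLES: the double `D W = W ∪_id W̄` of a compact contractible Stein domain with
planar contact boundary is diffeomorphic to `S⁴` — equivalently `W × I ≅ B⁵`.  (`W` is a planar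
positive allowable Lefschetz fibration by Wendl, so `W × I` is the 5-dimensional 2-handlebody of
a SQUARE-FREE CONJUGATE presentation, see `SquareFreeConjugateAC`.) -/
def PlanarSteinDoubleStandard : Prop :=
  ∀ (W : Type) [TopologicalSpace W] [T2Space W] [SecondCountableTopology W]
    [ChartedSpace (EuclideanHalfSpace 4) W] [IsManifold (𝓡∂ 4) ∞ W] [CompactSpace W]
    [ContractibleSpace W] (J : SteinStructure W) (b : BoundaryData (𝓡∂ 4) W (𝓡 3)),
    PlanarContactBoundary J →
    ∀ (X : Type) [TopologicalSpace X] [T2Space X] [SecondCountableTopology X]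
      [ChartedSpace (𝔼 4) X] [IsManifold (𝓡 4) ∞ X],
      IsDouble b (𝓡 4) X → Nonempty (X ≃ₘ⟮𝓡 4, 𝓡 4⟯ (𝕊 4))

/-- A balanced presentation is SQUARE-FREE CONJUGATE if every relator is a product, over a list
of pairwise DISTINCT generators, of conjugates of those generators (each with exponent `+1`).  The
relators read off a planar Lefschetz fibration — words of simple closed curves on a holed disc,
i.e. braid-automorphism images `β(x_{i₁} ⋯ x_{iₘ})` of standard boundary products — are of this
form (the planar case is the strict sub-class where the conjugators come coherently from ONE braid
automorphism per relator). -/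
def IsSquareFreeConjugate {n : ℕ} (P : BalancedPresentation n) : Prop :=
  ∀ i : Fin n, ∃ (l : List (Fin n)) (g : Fin n → FreeGroup (Fin n)), l.Nodup ∧
    P i = (l.map fun j => g j * FreeGroup.of j * (g j)⁻¹).prod

/-- SQUARE-FREE CONJUGATE ANDREWS–CURTIS (bold, typable superset of PLANAR-AC): every square-free
conjugate balanced presentation of the trivial group is stably Andrews–Curtis trivial.  PLANAR-AC
(relators = simple-closed-curve words) is the statement the line needs; this superset is its
cheapest falsifier. -/
def SquareFreeConjugateAC : Prop :=
  ∀ (n : ℕ) (P : BalancedPresentation n), IsSquareFreeConjugate P → P.PresentsTrivialGroup →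
    IsStablyAndrewsCurtisEquivalent P (BalancedPresentation.trivial n)

/-! ## Sanity: the crux decl is in scope and each first lemma is a Prop. -/
example : Prop := Summit.SmoothPoincare4.SmoothPoincare4.Theses.ConvexBisection.PlanarBisectionRigidity
example : Prop := OneSidedBallSeam
example : Prop := BindingNumberDissolution
example : Prop := ContactTwistedPlanarDouble
example : Prop := PlanarSteinDoubleStandard
example : Prop := SquareFreeConjugateAC

end Summit.SmoothPoincare4.SmoothPoincare4.Cruxes.PlanarBisectionRigidity.Sketch

end
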